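import Literature.NumberTheory.Automorphic.QuadraticHeckeCharacterRealPlaces
import HarnessLib

/-!
# The quadratic Hecke character on the infinite idèles `K_∞ˣ`, and its dependence on the square class only

Topic `NumberTheory/Automorphic`; namespace `Literature.NumberTheory.Automorphic`. Everything here is proved; a
corollary file of `QuadraticHeckeCharacterRealPlaces.lean`.

For a number field `K`, a non-square `θ ∈ 𝓞 K` and `ω = quadraticHeckeChar K θ` (the character of
`𝕀_K / P_K N_{K(√θ)/K} J`, O'Meara 65:21):

* `infiniteIdeles_eq_prod_infiniteIdeleSingle` — an infinite idèle is the product of its one-place pieces: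
  `(y, 1) = ∏_w ⟨y_w⟩_w` in `𝕀_K` for `y ∈ K_∞ˣ = (∏_w K_w)ˣ` (the tree's `GaloisRepresentations.infiniteIdeles` and
  `infiniteIdeleSingle`);
* `quadraticHeckeChar_infiniteIdeles` — hence `ω(y, 1) = ∏_w ω(⟨y_w⟩_w)`;
* **`quadraticHeckeChar_infiniteIdeles_of_forall_neg`** — if `K` is totally real and `θ` is totally negative
  (`v(θ) < 0` at every place), then `ω(y, 1) = ∏_v sgn(y_v)`: the ARCHIMEDEAN TYPE "`sgn` at every real place"
  (this is the situation `K = L⁺`, `L = L⁺(√θ)` a CM field; PerL v5 §3.2, tex ll. 305–307, uses exactly this type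
  for `ε_{L/L₀}`);
* `quadraticHeckeChar_infiniteIdeles_eq_one_of_forall_pos` — if every `y_v > 0` then `ω(y, 1) = 1` (any `K`, `θ`);
* **`quadraticHeckeChar_eq_of_mul_sq`** — `ω` only depends on the square class of `θ`:
  `quadraticHeckeChar K θ' = quadraticHeckeChar K θ` when `θ' = θ r²`, `r ∈ Kˣ` (the norm groups agree,
  O'Meara §65A).

## References

* O. T. O'Meara, *Introduction to Quadratic Forms*, Grundlehren 117 (1963), §63B, §65A (Example 65:2), §71D
  proof of Thm. 71:19. [Omeara1963]
-/

noncomputable section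

open scoped NumberField
open NumberField IsDedekindDomain NumberField.InfinitePlace

namespace Literature.NumberTheory.Automorphic

open QuadraticForms GaloisRepresentations

variable {K : Type} [Field K] [NumberField K]

/-! ## Infinite idèles as products of one-place idèles -/

/-- The `w`-component of the infinite idèle `(y, 1)` is `y_w` (definitional; the tree's `ideleInfiniteComponent`).
[folklore] -/
theorem ideleInfiniteComponent_infiniteIdeles (y : (InfiniteAdeleRing K)ˣ) (w : InfinitePlace K) :
    ((ideleInfiniteComponent K w (infiniteIdeles K y) : (w.Completion)ˣ) : w.Completion) =
      (y : InfiniteAdeleRing K) w := rfl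

/-- The finite components of the infinite idèle `(y, 1)` are `1`. [folklore] -/
theorem ideleFiniteComponent_infiniteIdeles (y : (InfiniteAdeleRing K)ˣ) (v : HeightOneSpectrum (𝓞 K)) :
    ideleFiniteComponent K v (infiniteIdeles K y) = 1 :=
  Units.ext (infiniteIdeles_snd y v)

/-- **`(y, 1) = ∏_w ⟨y_w⟩_w`**: an infinite idèle is the (finite) product over the infinite places of the idèles
supported at one place (equality of idèles checked on components, `ideleInfiniteComponent` /
`ideleFiniteComponent`). [folklore] -/
theorem infiniteIdeles_eq_prod_infiniteIdeleSingle (y : (InfiniteAdeleRing K)ˣ) :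
    infiniteIdeles K y =
      ∏ w : InfinitePlace K, infiniteIdeleSingle w (ideleInfiniteComponent K w (infiniteIdeles K y)) := by
  classical
  set t : ideleGroup K :=
    ∏ w : InfinitePlace K, infiniteIdeleSingle w (ideleInfiniteComponent K w (infiniteIdeles K y)) with ht
  have h1 : ∀ w' : InfinitePlace K,
      ideleInfiniteComponent K w' t = ideleInfiniteComponent K w' (infiniteIdeles K y) := fun w' => by
    rw [ht, map_prod, Finset.prod_eq_single w'
      (fun w _ hw => ideleInfiniteComponent_infiniteIdeleSingle_of_ne K _ (Ne.symm hw))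
      (fun h => absurd (Finset.mem_univ w') h), ideleInfiniteComponent_infiniteIdeleSingle_self]
  have h2 : ∀ v : HeightOneSpectrum (𝓞 K),
      ideleFiniteComponent K v t = ideleFiniteComponent K v (infiniteIdeles K y) := fun v => by
    rw [ht, map_prod, Finset.prod_eq_one (fun w _ => ideleFiniteComponent_infiniteIdeleSingle K w _ v),
      ideleFiniteComponent_infiniteIdeles]
  refine Units.ext (Prod.ext (funext fun w' => ?_) (RestrictedProduct.ext _ _ fun v => ?_))
  · exact (congrArg (fun u : (w'.Completion)ˣ => (u : w'.Completion)) (h1 w')).symm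
  · exact (congrArg (fun u : (v.adicCompletion K)ˣ => (u : v.adicCompletion K)) (h2 v)).symm

/-- `ω(y, 1) = ∏_w ω(⟨y_w⟩_w)` for the quadratic Hecke character `ω`. [folklore] -/
theorem quadraticHeckeChar_infiniteIdeles {θ : 𝓞 K} (hθ : ¬ IsSquare (θ : K)) (y : (InfiniteAdeleRing K)ˣ) :
    quadraticHeckeChar K θ hθ (infiniteIdeles K y) =
      ∏ w : InfinitePlace K,
        quadraticHeckeChar K θ hθ (infiniteIdeleSingle w (ideleInfiniteComponent K w (infiniteIdeles K y))) := by
  rw [← map_prod]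
  exact congrArg _ (infiniteIdeles_eq_prod_infiniteIdeleSingle y)

/-- If every component `y_w` at a real place is positive then `ω(y, 1) = 1` (complex places never contribute).
[cite: Omeara1963, §63B] -/
theorem quadraticHeckeChar_infiniteIdeles_eq_one_of_forall_pos {θ : 𝓞 K} (hθ : ¬ IsSquare (θ : K))
    (y : (InfiniteAdeleRing K)ˣ)
    (hpos : ∀ (w : InfinitePlace K) (hw : w.IsReal),
      0 < Completion.ringEquivRealOfIsReal hw ((y : InfiniteAdeleRing K) w)) :
    quadraticHeckeChar K θ hθ (infiniteIdeles K y) = 1 := by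
  rw [quadraticHeckeChar_infiniteIdeles]
  refine Finset.prod_eq_one fun w _ => ?_
  by_cases hw : w.IsReal
  · exact (quadraticHeckeChar_infiniteIdeleSingle_eq_one_iff_of_isReal hθ hw _).2 (Or.inl (hpos w hw))
  · exact quadraticHeckeChar_infiniteIdeleSingle_of_isComplex hθ (not_isReal_iff_isComplex.1 hw) _

/-- **Archimedean type `sgn` at every place.** For `K` totally real and `θ` totally negative (`v(θ) < 0` at every
place `v`; e.g. `K = L⁺`, `L = L⁺(√θ)` a CM field), `ω(y, 1) = ∏_v sgn(y_v)` for `y ∈ K_∞ˣ`.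
[cite: Omeara1963, §71D proof of Thm. 71:19] -/
theorem quadraticHeckeChar_infiniteIdeles_of_forall_neg [IsTotallyReal K] {θ : 𝓞 K} (hθ : ¬ IsSquare (θ : K))
    (hneg : ∀ v : InfinitePlace K, embedding_of_isReal (IsTotallyReal.isReal v) (θ : K) < 0)
    (y : (InfiniteAdeleRing K)ˣ) :
    ((quadraticHeckeChar K θ hθ (infiniteIdeles K y) : ℂˣ) : ℂ) =
      ∏ v : InfinitePlace K,
        (if 0 < Completion.ringEquivRealOfIsReal (IsTotallyReal.isReal v) ((y : InfiniteAdeleRing K) v)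
          then (1 : ℂ) else -1) := by
  rw [quadraticHeckeChar_infiniteIdeles, Units.coe_prod]
  refine Finset.prod_congr rfl fun v _ => ?_
  rw [quadraticHeckeChar_infiniteIdeleSingle_of_neg hθ (IsTotallyReal.isReal v) (hneg v)]
  rfl

/-! ## Dependence on the square class of `θ` only -/

variable (K) in
/-- `N_{K(√(a r²))/K} J = N_{K(√a)/K} J` for `r ≠ 0` (this is `QuadraticForms.normIdeles_mul_sq` of
`QuadraticArtinReciprocity.lean`, re-derived here from `quadraticNormSubgroup_mul_sq` to keep that file's
Artin-reciprocity chain out of the imports). [folklore] -/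
private theorem normIdeles_mul_sq' (a : K) {r : K} (hr : r ≠ 0) : normIdeles K (a * r ^ 2) = normIdeles K a := by
  ext i
  simp only [mem_normIdeles_iff, map_mul, map_pow]
  refine and_congr (forall_congr' fun v => ?_) (forall_congr' fun w => ?_)
  · rw [quadraticNormSubgroup_mul_sq _ ((_root_.map_ne_zero _).2 hr)]
  · rw [quadraticNormSubgroup_mul_sq _ ((_root_.map_ne_zero _).2 hr)]

/-- **The quadratic Hecke character only depends on the square class of `θ`**: if `θ' = θ r²` with `r ∈ Kˣ`
then `quadraticHeckeChar K θ' = quadraticHeckeChar K θ` (both are the sign character of the same index-two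
subgroup `P_K · N J`, `N_{K(√θ')/K} J = N_{K(√θ)/K} J`). [cite: Omeara1963, §65A Example 65:2] -/
theorem quadraticHeckeChar_eq_of_mul_sq {θ θ' : 𝓞 K} (hθ : ¬ IsSquare (θ : K)) (hθ' : ¬ IsSquare (θ' : K))
    {r : K} (hr : r ≠ 0) (h : (θ' : K) = θ * r ^ 2) :
    quadraticHeckeChar K θ' hθ' = quadraticHeckeChar K θ hθ := by
  have hN : normIdeles K (θ' : K) = normIdeles K (θ : K) := by rw [h, normIdeles_mul_sq' K _ hr]
  ext1 x
  by_cases hx : x ∈ principalIdeles K ⊔ normIdeles K (θ : K)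
  · rw [quadraticHeckeChar_apply_of_mem hθ hx, quadraticHeckeChar_apply_of_mem hθ' (by rwa [hN])]
  · rw [quadraticHeckeChar_apply_of_not_mem hθ hx, quadraticHeckeChar_apply_of_not_mem hθ' (by rwa [hN])]

end Literature.NumberTheory.Automorphic

end
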